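import Summits.SmoothPoincare4.SmoothPoincare4.Theorems.NormalFormStablyTrivial.Negative.PairRankObstruction

/-!
# `NormalFormStablyTrivial` — negative-side support II: the gate needs BOTH sides
# (each pair condition is load-bearing in the triple form; the unbalanced trisections of `ℂP²`)

Refuter support file (cdisprove seat) for crux item stmt-SmoothPoincare4-14591
(`CongruenceShadows.NormalFormStablyTrivial`).  By `TripleLoadBearing.lean` the crux is
`∀ m K, π₁ = 1 → PairsStandard m K → K.IsStablyTrivial`, and modulo Nielsen it is its gate form:
`(N₀, N₁, K₂)` with `π₁ = 1` and `K₂ ∈ Stab(N₀)·N₂ ∩ Stab(N₁)·N₂` is stably trivial.  Here: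

* (toolkit in `PairRankObstruction.lean`: pair ranks are stable invariants —
  `not_isStablyTrivial_of_pairRank` — and the Dehn twists `twB h = T_{b_h}`.)
* `gate_false_without_gamma` / `gate_false_without_beta` — **the gate needs both sides**: with
  `(K₀,K₁) = (N₀,N₁)`, `π₁ = 1` and only `K₂ ∈ Stab(N₀)·N₂` (resp. only `K₂ ∈ Stab(N₁)·N₂`),
  stable triviality FAILS at `m = 0`: `K₂ = T_{b₂} N₂ = ⟪b₀, a₁, a₂b₂⟫` (resp. `T_{b₁} N₂ =
  ⟪b₀, a₁b₁, a₂⟫`), the Dehn twist about `b₂` (resp. `b₁`) lying in the handlebody group of `N₀`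
  (resp. `N₁`); the resulting triple is the UNBALANCED genus-3 trisection of `ℂP²` with pair ranks `(k₀₁,k₀₂,k₁₂) = (1,1,0)`
  (resp. `(1,0,1)`) (genus-one `(a,b,ab)` summand on handle 2, resp. 1), simply connected but with a pair
  quotient of rank `0 ≠ 1`.  In the card's language: `A·C` and `B·C` each contain `ℂP²`; only the
  intersection `AC ∩ BC` can equal `(A∩B)·C` stably.
* `tripleForm_false_without_pair12` / `_pair02` / `_pair01` — equivalently, in the triple form of
  the crux EACH of the three pair conditions is load-bearing (the third witness is
  `(N₀, T_{b₀}N₁, N₂)`, `T_{b₀} ∈ Stab N₂`).  (In the original form, with `IsGroupTrisection`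
  supplying the ranks, the pair conditions are theorems on paper — crux `WaldhausenPairs` — and
  dropping them gives AGK's condition `X`, SPC4-equivalent: not attackable.)

Everything is proved; the only definitions are the three witness triples (by `Function.update`).  Nothing here concludes a Theses statement.

References: D. Gay, R. Kirby, *Trisecting 4-manifolds*, Geom. Topol. 20 (2016), §2 (genus-one
trisection `(a, b, a+b)` of `ℂP²`; unbalanced stabilisation); J. Meier, T. Schirmer, A. Zupan,
*Classification of trisections and the generalized property R conjecture*, PAMS 144 (2016)
(unbalanced trisections); A. Abrams, D. Gay, R. Kirby, Geom. Topol. 22 (2018), Def. 2–3.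
-/

-- the prescribed namespace `Summit.<P>.<Sub>.…` duplicates `SmoothPoincare4` (P = Sub)
set_option linter.dupNamespace false

noncomputable section

namespace Summit.SmoothPoincare4.SmoothPoincare4.Theorems.NormalFormStablyTrivial.Negative

open Literature.Topology.FourManifolds Subgroup RelatorAut
open Summit.SmoothPoincare4.SmoothPoincare4.Theorems.AgkCor6Sufficiency.Negative
  (za zb subsingleton_quotient_of_forall_of_mem)

/-! ## §3 Three unbalanced trisections of `ℂP²` and their pair ranks -/

/-- `(N₀, N₁, T_{b₂}N₂)`: unbalanced genus-3 trisection of `ℂP²`, pair ranks `(k₀₁,k₀₂,k₁₂) =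
(1,1,0)` (`ℂP²` summand on handle 2).
(Defined by `Function.update`, not `![…]`: unification of two `![…]` literals is pathological.)
[folklore] -/
def cpA : TrisectionKernels 3 :=
  Function.update s4Kernels 2 (normalClosure {zb 0, za 1, za 2 * zb 2})
/-- `(N₀, N₁, T_{b₁}N₂)`: unbalanced genus-3 trisection of `ℂP²`, pair ranks `(1,0,1)`
(`ℂP²` summand on handle 1).
[folklore] -/
def cpB : TrisectionKernels 3 :=
  Function.update s4Kernels 2 (normalClosure {zb 0, za 1 * zb 1, za 2})
/-- `(N₀, T_{b₀}N₁, N₂)`: unbalanced genus-3 trisection of `ℂP²`, pair ranks `(0,1,1)`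
(`ℂP²` summand on handle 0).
[folklore] -/
def cpC : TrisectionKernels 3 :=
  Function.update s4Kernels 1 (normalClosure {za 0 * zb 0, zb 1, za 2})

/-- slot `0` of `cpA`. [folklore] -/
theorem cpA_zero : cpA 0 = s4Kernels 0 := Function.update_of_ne (by decide) _ _
/-- slot `1` of `cpA`. [folklore] -/
theorem cpA_one : cpA 1 = s4Kernels 1 := Function.update_of_ne (by decide) _ _
/-- slot `2` of `cpA`. [folklore] -/
theorem cpA_two : cpA 2 = normalClosure {zb 0, za 1, za 2 * zb 2} := Function.update_self _ _ _
/-- slot `0` of `cpB`. [folklore] -/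
theorem cpB_zero : cpB 0 = s4Kernels 0 := Function.update_of_ne (by decide) _ _
/-- slot `1` of `cpB`. [folklore] -/
theorem cpB_one : cpB 1 = s4Kernels 1 := Function.update_of_ne (by decide) _ _
/-- slot `2` of `cpB`. [folklore] -/
theorem cpB_two : cpB 2 = normalClosure {zb 0, za 1 * zb 1, za 2} := Function.update_self _ _ _
/-- slot `0` of `cpC`. [folklore] -/
theorem cpC_zero : cpC 0 = s4Kernels 0 := Function.update_of_ne (by decide) _ _
/-- slot `1` of `cpC`. [folklore] -/
theorem cpC_one : cpC 1 = normalClosure {za 0 * zb 0, zb 1, za 2} := Function.update_self _ _ _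
/-- slot `2` of `cpC`. [folklore] -/
theorem cpC_two : cpC 2 = s4Kernels 2 := Function.update_of_ne (by decide) _ _

/-- `s4Kernels.stabilizeIter 0 = s4Kernels`. [folklore] -/
theorem s4Kernels_stabilizeIter_zero : s4Kernels.stabilizeIter 0 = s4Kernels := rfl

section ranks

/-- If `x ∈ H` and `x * y ∈ H` then `y ∈ H`. [folklore] -/
theorem mem_of_mul_mem_left {G : Type*} [Group G] {H : Subgroup G} {x y : G} (hx : x ∈ H)
    (hxy : x * y ∈ H) : y ∈ H := by
  simpa using H.mul_mem (H.inv_mem hx) hxy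

variable (K : TrisectionKernels 3)

/-- Generators of a standard slot die in the triple quotient. [folklore] -/
theorem of_mem_nc_iUnion_of_eq {l : Fin 3} (hl : K l = s4Kernels l) {y : surfaceGen 3}
    (hy : y ∈ s4Gens l) :
    (PresentedGroup.of y : SurfaceGroup 3) ∈ normalClosure (⋃ i, (K i : Set (SurfaceGroup 3))) := by
  refine subset_normalClosure (Set.mem_iUnion.2 ⟨l, ?_⟩)
  rw [hl]
  exact of_mem_s4Kernels l hy

/-- Members of an explicit slot die in the triple quotient. [folklore] -/
theorem mem_nc_iUnion_of_eq {l : Fin 3} {s : Set (SurfaceGroup 3)} (hl : K l = normalClosure s)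
    {y : SurfaceGroup 3} (hy : y ∈ s) :
    y ∈ normalClosure (⋃ i, (K i : Set (SurfaceGroup 3))) := by
  refine subset_normalClosure (Set.mem_iUnion.2 ⟨l, ?_⟩)
  rw [hl]
  exact subset_normalClosure hy

/-- Generators of a standard slot die in a pair quotient (left slot). [folklore] -/
theorem of_mem_nc_union_left {i j : Fin 3} (hi : K i = s4Kernels i) {y : surfaceGen 3}
    (hy : y ∈ s4Gens i) :
    (PresentedGroup.of y : SurfaceGroup 3) ∈
      normalClosure ((K i : Set (SurfaceGroup 3)) ∪ K j) := by
  refine subset_normalClosure (Or.inl ?_)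
  rw [hi]
  exact of_mem_s4Kernels i hy

/-- Members of an explicit slot die in a pair quotient (right slot). [folklore] -/
theorem mem_nc_union_right {i j : Fin 3} {s : Set (SurfaceGroup 3)} (hj : K j = normalClosure s)
    {y : SurfaceGroup 3} (hy : y ∈ s) :
    y ∈ normalClosure ((K i : Set (SurfaceGroup 3)) ∪ K j) := by
  refine subset_normalClosure (Or.inr ?_)
  rw [hj]
  exact subset_normalClosure hy

variable {K}

/-- `π₁ = 1` for `cpA`: every generator dies in the triple quotient. [folklore] -/
theorem subsingleton_tripleQuotient_cpA : Subsingleton cpA.tripleQuotient := by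
  refine subsingleton_quotient_of_forall_of_mem _ fun x => ?_
  obtain ⟨k, b⟩ := x
  fin_cases k <;> cases b
  · exact of_mem_nc_iUnion_of_eq cpA cpA_zero (l := 0) (by decide)
  · exact mem_nc_iUnion_of_eq cpA cpA_two (by simp [zb])
  · exact of_mem_nc_iUnion_of_eq cpA cpA_zero (l := 0) (by decide)
  · exact of_mem_nc_iUnion_of_eq cpA cpA_one (l := 1) (by decide)
  · exact of_mem_nc_iUnion_of_eq cpA cpA_one (l := 1) (by decide)
  · exact of_mem_nc_iUnion_of_eq cpA cpA_zero (l := 0) (by decide)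

/-- `π₁ = 1` for `cpB`. [folklore] -/
theorem subsingleton_tripleQuotient_cpB : Subsingleton cpB.tripleQuotient := by
  refine subsingleton_quotient_of_forall_of_mem _ fun x => ?_
  obtain ⟨k, b⟩ := x
  fin_cases k <;> cases b
  · exact of_mem_nc_iUnion_of_eq cpB cpB_zero (l := 0) (by decide)
  · exact mem_nc_iUnion_of_eq cpB cpB_two (by simp [zb])
  · exact of_mem_nc_iUnion_of_eq cpB cpB_zero (l := 0) (by decide)
  · exact of_mem_nc_iUnion_of_eq cpB cpB_one (l := 1) (by decide)
  · exact of_mem_nc_iUnion_of_eq cpB cpB_one (l := 1) (by decide)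
  · exact of_mem_nc_iUnion_of_eq cpB cpB_zero (l := 0) (by decide)

/-- `π₁ = 1` for `cpC`. [folklore] -/
theorem subsingleton_tripleQuotient_cpC : Subsingleton cpC.tripleQuotient := by
  refine subsingleton_quotient_of_forall_of_mem _ fun x => ?_
  obtain ⟨k, b⟩ := x
  fin_cases k <;> cases b
  · exact of_mem_nc_iUnion_of_eq cpC cpC_zero (l := 0) (by decide)
  · exact of_mem_nc_iUnion_of_eq cpC cpC_two (l := 2) (by decide)
  · exact of_mem_nc_iUnion_of_eq cpC cpC_zero (l := 0) (by decide)
  · exact mem_nc_iUnion_of_eq cpC cpC_one (by simp [zb])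
  · exact of_mem_nc_iUnion_of_eq cpC cpC_two (l := 2) (by decide)
  · exact of_mem_nc_iUnion_of_eq cpC cpC_zero (l := 0) (by decide)

/-- The `(1,2)` pair quotient of `cpA` is TRIVIAL (rank `0`, not `1`): `(N₁, T_{b₂}N₂)` is a
genus-3 splitting of `S³`, not of `S¹×S²`. [folklore] -/
theorem isFreeOfRank_pairQuotient_cpA : IsFreeOfRank (cpA.pairQuotient 1 2) 0 := by
  haveI : Subsingleton (cpA.pairQuotient 1 2) := by
    refine subsingleton_quotient_of_forall_of_mem _ fun x => ?_
    have hb2 : zb 2 ∈ normalClosure ((cpA 1 : Set (SurfaceGroup 3)) ∪ cpA 2) :=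
      mem_of_mul_mem_left (of_mem_nc_union_left cpA cpA_one (y := ((2 : Fin 3), false)) (by decide))
        (mem_nc_union_right cpA cpA_two (y := za 2 * zb 2) (by simp))
    obtain ⟨k, b⟩ := x
    fin_cases k <;> cases b
    · exact of_mem_nc_union_left cpA cpA_one (by decide)
    · exact mem_nc_union_right cpA cpA_two (by simp [zb])
    · exact mem_nc_union_right cpA cpA_two (by simp [za])
    · exact of_mem_nc_union_left cpA cpA_one (by decide)
    · exact of_mem_nc_union_left cpA cpA_one (by decide)
    · exact hb2
  exact isFreeOfRank_zero_of_subsingleton _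

/-- The `(0,2)` pair quotient of `cpB` is trivial. [folklore] -/
theorem isFreeOfRank_pairQuotient_cpB : IsFreeOfRank (cpB.pairQuotient 0 2) 0 := by
  haveI : Subsingleton (cpB.pairQuotient 0 2) := by
    refine subsingleton_quotient_of_forall_of_mem _ fun x => ?_
    have hb1 : zb 1 ∈ normalClosure ((cpB 0 : Set (SurfaceGroup 3)) ∪ cpB 2) :=
      mem_of_mul_mem_left (of_mem_nc_union_left cpB cpB_zero (y := ((1 : Fin 3), false)) (by decide))
        (mem_nc_union_right cpB cpB_two (y := za 1 * zb 1) (by simp))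
    obtain ⟨k, b⟩ := x
    fin_cases k <;> cases b
    · exact of_mem_nc_union_left cpB cpB_zero (by decide)
    · exact mem_nc_union_right cpB cpB_two (by simp [zb])
    · exact of_mem_nc_union_left cpB cpB_zero (by decide)
    · exact hb1
    · exact mem_nc_union_right cpB cpB_two (by simp [za])
    · exact of_mem_nc_union_left cpB cpB_zero (by decide)
  exact isFreeOfRank_zero_of_subsingleton _

/-- The `(0,1)` pair quotient of `cpC` is trivial. [folklore] -/
theorem isFreeOfRank_pairQuotient_cpC : IsFreeOfRank (cpC.pairQuotient 0 1) 0 := by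
  haveI : Subsingleton (cpC.pairQuotient 0 1) := by
    refine subsingleton_quotient_of_forall_of_mem _ fun x => ?_
    have hb0 : zb 0 ∈ normalClosure ((cpC 0 : Set (SurfaceGroup 3)) ∪ cpC 1) :=
      mem_of_mul_mem_left (of_mem_nc_union_left cpC cpC_zero (y := ((0 : Fin 3), false)) (by decide))
        (mem_nc_union_right cpC cpC_one (y := za 0 * zb 0) (by simp))
    obtain ⟨k, b⟩ := x
    fin_cases k <;> cases b
    · exact of_mem_nc_union_left cpC cpC_zero (by decide)
    · exact hb0
    · exact of_mem_nc_union_left cpC cpC_zero (by decide)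
    · exact mem_nc_union_right cpC cpC_one (by simp [zb])
    · exact mem_nc_union_right cpC cpC_one (by simp [za])
    · exact of_mem_nc_union_left cpC cpC_zero (by decide)
  exact isFreeOfRank_zero_of_subsingleton _

end ranks

/-- `cpA` is not stably trivial (pair rank `0 ≠ 1`). [folklore] -/
theorem not_isStablyTrivial_cpA : ¬ cpA.IsStablyTrivial :=
  not_isStablyTrivial_of_pairRank (m := 0) (by decide) isFreeOfRank_pairQuotient_cpA (by decide)

/-- `cpB` is not stably trivial. [folklore] -/
theorem not_isStablyTrivial_cpB : ¬ cpB.IsStablyTrivial :=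
  not_isStablyTrivial_of_pairRank (m := 0) (by decide) isFreeOfRank_pairQuotient_cpB (by decide)

/-- `cpC` is not stably trivial. [folklore] -/
theorem not_isStablyTrivial_cpC : ¬ cpC.IsStablyTrivial :=
  not_isStablyTrivial_of_pairRank (m := 0) (by decide) isFreeOfRank_pairQuotient_cpC (by decide)

/-! ## §4 The gate needs both sides; each pair condition is load-bearing in the triple form -/

/-- **GATE NEEDS BOTH SIDES (I).**  `(K₀,K₁) = (N₀,N₁)`, `π₁ = 1` and `K₂ ∈ Stab(N₀)·N₂` do NOT
give stable triviality: `K₂ = T_{b₂}N₂` (`ℂP²`). [folklore] -/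
theorem gate_false_without_gamma :
    ¬ ∀ (m : ℕ) (K : TrisectionKernels (3 + 3 * m)),
      K 0 = s4Kernels.stabilizeIter m 0 → K 1 = s4Kernels.stabilizeIter m 1 →
      Subsingleton K.tripleQuotient →
      (∃ β : SurfaceGroup (3 + 3 * m) ≃* SurfaceGroup (3 + 3 * m),
        (s4Kernels.stabilizeIter m 0).map β.toMonoidHom = s4Kernels.stabilizeIter m 0 ∧
        (s4Kernels.stabilizeIter m 2).map β.toMonoidHom = K 2) →
      K.IsStablyTrivial := by
  intro h
  have h0 := h 0
  rw [s4Kernels_stabilizeIter_zero] at h0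
  exact not_isStablyTrivial_cpA (h0 cpA cpA_zero cpA_one subsingleton_tripleQuotient_cpA
    ⟨(twB 2).toMulEquiv, map_twB2_s4Kernels_zero, map_twB2_s4Kernels_two.trans cpA_two.symm⟩)

/-- **GATE NEEDS BOTH SIDES (II).**  `(K₀,K₁) = (N₀,N₁)`, `π₁ = 1` and `K₂ ∈ Stab(N₁)·N₂` do NOT
give stable triviality: `K₂ = T_{b₁}N₂` (`ℂP²`). [folklore] -/
theorem gate_false_without_beta :
    ¬ ∀ (m : ℕ) (K : TrisectionKernels (3 + 3 * m)),
      K 0 = s4Kernels.stabilizeIter m 0 → K 1 = s4Kernels.stabilizeIter m 1 →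
      Subsingleton K.tripleQuotient →
      (∃ γ : SurfaceGroup (3 + 3 * m) ≃* SurfaceGroup (3 + 3 * m),
        (s4Kernels.stabilizeIter m 1).map γ.toMonoidHom = s4Kernels.stabilizeIter m 1 ∧
        (s4Kernels.stabilizeIter m 2).map γ.toMonoidHom = K 2) →
      K.IsStablyTrivial := by
  intro h
  have h0 := h 0
  rw [s4Kernels_stabilizeIter_zero] at h0
  exact not_isStablyTrivial_cpB (h0 cpB cpB_zero cpB_one subsingleton_tripleQuotient_cpB
    ⟨(twB 1).toMulEquiv, map_twB1_s4Kernels_one, map_twB1_s4Kernels_two.trans cpB_two.symm⟩)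

/-- **Each pair condition is load-bearing in the triple form (pair `(1,2)`).** [folklore] -/
theorem tripleForm_false_without_pair12 :
    ¬ ∀ (m : ℕ) (K : TrisectionKernels (3 + 3 * m)), Subsingleton K.tripleQuotient →
      (∃ α : SurfaceGroup (3 + 3 * m) ≃* SurfaceGroup (3 + 3 * m),
        (s4Kernels.stabilizeIter m 0).map α.toMonoidHom = K 0 ∧
        (s4Kernels.stabilizeIter m 1).map α.toMonoidHom = K 1) →
      (∃ α : SurfaceGroup (3 + 3 * m) ≃* SurfaceGroup (3 + 3 * m),
        (s4Kernels.stabilizeIter m 0).map α.toMonoidHom = K 0 ∧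
        (s4Kernels.stabilizeIter m 2).map α.toMonoidHom = K 2) →
      K.IsStablyTrivial := by
  intro h
  have h0 := h 0
  rw [s4Kernels_stabilizeIter_zero] at h0
  refine not_isStablyTrivial_cpA (h0 cpA subsingleton_tripleQuotient_cpA
    ⟨MulEquiv.refl _, ?_, ?_⟩
    ⟨(twB 2).toMulEquiv, map_twB2_s4Kernels_zero.trans cpA_zero.symm,
      map_twB2_s4Kernels_two.trans cpA_two.symm⟩)
  · simpa using cpA_zero.symm
  · simpa using cpA_one.symm

/-- **Each pair condition is load-bearing in the triple form (pair `(0,2)`).** [folklore] -/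
theorem tripleForm_false_without_pair02 :
    ¬ ∀ (m : ℕ) (K : TrisectionKernels (3 + 3 * m)), Subsingleton K.tripleQuotient →
      (∃ α : SurfaceGroup (3 + 3 * m) ≃* SurfaceGroup (3 + 3 * m),
        (s4Kernels.stabilizeIter m 0).map α.toMonoidHom = K 0 ∧
        (s4Kernels.stabilizeIter m 1).map α.toMonoidHom = K 1) →
      (∃ α : SurfaceGroup (3 + 3 * m) ≃* SurfaceGroup (3 + 3 * m),
        (s4Kernels.stabilizeIter m 1).map α.toMonoidHom = K 1 ∧
        (s4Kernels.stabilizeIter m 2).map α.toMonoidHom = K 2) →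
      K.IsStablyTrivial := by
  intro h
  have h0 := h 0
  rw [s4Kernels_stabilizeIter_zero] at h0
  refine not_isStablyTrivial_cpB (h0 cpB subsingleton_tripleQuotient_cpB
    ⟨MulEquiv.refl _, ?_, ?_⟩
    ⟨(twB 1).toMulEquiv, map_twB1_s4Kernels_one.trans cpB_one.symm,
      map_twB1_s4Kernels_two.trans cpB_two.symm⟩)
  · simpa using cpB_zero.symm
  · simpa using cpB_one.symm

/-- **Each pair condition is load-bearing in the triple form (pair `(0,1)`).** [folklore] -/
theorem tripleForm_false_without_pair01 :
    ¬ ∀ (m : ℕ) (K : TrisectionKernels (3 + 3 * m)), Subsingleton K.tripleQuotient →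
      (∃ α : SurfaceGroup (3 + 3 * m) ≃* SurfaceGroup (3 + 3 * m),
        (s4Kernels.stabilizeIter m 0).map α.toMonoidHom = K 0 ∧
        (s4Kernels.stabilizeIter m 2).map α.toMonoidHom = K 2) →
      (∃ α : SurfaceGroup (3 + 3 * m) ≃* SurfaceGroup (3 + 3 * m),
        (s4Kernels.stabilizeIter m 1).map α.toMonoidHom = K 1 ∧
        (s4Kernels.stabilizeIter m 2).map α.toMonoidHom = K 2) →
      K.IsStablyTrivial := by
  intro h
  have h0 := h 0
  rw [s4Kernels_stabilizeIter_zero] at h0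
  refine not_isStablyTrivial_cpC (h0 cpC subsingleton_tripleQuotient_cpC
    ⟨MulEquiv.refl _, ?_, ?_⟩
    ⟨(twB 0).toMulEquiv, map_twB0_s4Kernels_one.trans cpC_one.symm,
      map_twB0_s4Kernels_two.trans cpC_two.symm⟩)
  · simpa using cpC_zero.symm
  · simpa using cpC_two.symm

end Summit.SmoothPoincare4.SmoothPoincare4.Theorems.NormalFormStablyTrivial.Negative

end
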